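import Mathlib
import HarnessLib
import Summits.ValiantsHypothesis.ValiantsHypothesis.Theorems.MonotoneRestorationOrbitRestorationQPCorePatternsAffine
import Summits.ValiantsHypothesis.ValiantsHypothesis.Theorems.MonotoneRestorationOrbitRestorationQPNarrowSpanNewton

/-!
# Products of CROSS-LOCAL affine forms (`|R|, |C| ≤ 1`) are narrow with treewidth `≤ 3` — SPAN currency, end to end

Route MonotoneRestoration, crux `OrbitRestorationQP` (stmt-ValiantsHypothesis-18293), SPAN-currency lane of the open
sub-rung A_∞ (`stub_sigmaPiSigmaValue`); evidence note `SPAN-CURRENCY-A1-g7g4.md` §2 (untwisted `ΠΣ`).  Helper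
(`--supports`), def-free.

A CROSS-LOCAL affine form is `ℓ_{ab} = β₀ + δ U + α x_{ab} + β R_a + γ C_b` (`R_a`, `C_b` the row / column sums, `U` the
total sum): a local form whose row and column supports have at most ONE element each.  For such cores the passage
"all placements → injective placements" of the untwisted programme is EMPTY (a map from `Fin 1` is injective), so the
landed engine (`CorePatterns.sum_placements_pow_affineLocalForm_mem_narrowSpan`) and Newton in span currency
(`NarrowSpanNewton.prod_mem_narrowSpan_of_psum_mem`) already give the theorem:

* **`prod_crossLocal_mem_narrowSpan_three`** — for all `n, β₀, δ, α, β, γ`: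
  `Π_{a,b<n} (β₀ + δ U + α x_{ab} + β R_a + γ C_b) ∈ span_ℂ {hom_{F,n} : tw F ≤ 3}`;
* `prod_rowLocal_mem_narrowSpan_two` — `Π_{a<n} (β₀ + δ U + β R_a) ∈ span_ℂ {hom_{F,n} : tw F ≤ 2}`
  (and the column version `prod_colLocal_mem_narrowSpan_two`);
* these are matrix-symmetric `ΠΣ` families (`n²`, resp. `n`, affine factors; e.g. `Π_{a,b} (x_{ab} + R_a + C_b)`,
  `Π_a (1 + U − 2 R_a)`), and products of such blocks stay narrow (`NarrowSpanAlgebra.narrowSpan_mul_mem`).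

So every matrix-symmetric `ΠΣ` family assembled from support-`≤ 1` orbit blocks is narrow with CONSTANT treewidth `3`
(polynomial orbits); the general untwisted case (supports `≤ c+1`) needs only the injective-placement step.
Honest label: a sub-class of the `ΠΣ` sub-rung; the stub, the crux and VP ≠ VNP are not moved.
-/

noncomputable section

-- `Summit.ValiantsHypothesis.ValiantsHypothesis.…` is the tree's single-conjunct layout (Sub = Summit).
set_option linter.dupNamespace false

namespace Summit.ValiantsHypothesis.ValiantsHypothesis.Theorems

namespace SupportOneProducts

open MvPolynomial Finset
open Literature.Computability.AlgebraicComplexity (homPoly)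
open Literature.Combinatorics.SimpleGraph (treewidth)

/-- Sums over `Fin 1 → Fin n` are sums over `Fin n`. [folklore] -/
theorem sum_fin_one_arrow {M : Type*} [AddCommMonoid M] (n : ℕ) (F : (Fin 1 → Fin n) → M) :
    ∑ φ : Fin 1 → Fin n, F φ = ∑ a : Fin n, F (fun _ => a) := by
  refine Fintype.sum_equiv (Equiv.funUnique (Fin 1) (Fin n)) _ _ fun φ => ?_
  congr 1
  funext i
  rw [Subsingleton.elim i 0]
  rfl

/-- **Cross-local products are narrow with treewidth `≤ 3`.**  For all `n` and all coefficients,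
`Π_{a,b} (β₀ + δ U + α x_{ab} + β R_a + γ C_b) ∈ span_ℂ {hom_{F,n} : tw F ≤ 3}`. [folklore; cite: DwivediPagoSeppelt2026, §8] -/
theorem prod_crossLocal_mem_narrowSpan_three (n : ℕ) (β₀ δ α β γ : ℂ) :
    (∏ ab : Fin n × Fin n,
      (C β₀ + C δ * ∑ i : Fin n, ∑ j : Fin n, (X (i, j) : MvPolynomial (Fin n × Fin n) ℂ) +
        (C α * (X (ab.1, ab.2) : MvPolynomial (Fin n × Fin n) ℂ) +
          C β * ∑ j : Fin n, (X (ab.1, j) : MvPolynomial (Fin n × Fin n) ℂ) +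
          C γ * ∑ j : Fin n, (X (j, ab.2) : MvPolynomial (Fin n × Fin n) ℂ)))) ∈
      Submodule.span ℂ {p : MvPolynomial (Fin n × Fin n) ℂ |
        ∃ (a b : ℕ) (E : Multiset (Fin a × Fin b)),
          treewidth (SimpleGraph.fromRel fun u v : Fin a ⊕ Fin b =>
            ∃ e ∈ E, u = Sum.inl e.1 ∧ v = Sum.inr e.2) ≤ 3 ∧ p = homPoly E n ℂ} := by
  refine NarrowSpanNewton.prod_mem_narrowSpan_of_psum_mem n 3 _ fun m => ?_
  -- the power sum is the all-placements sum of the affine engine with core `Fin 1 × Fin 1`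
  have h := CorePatterns.sum_placements_pow_affineLocalForm_mem_narrowSpan n 1 1 m β₀ δ
    (fun _ => α) (fun _ => β) (fun _ => γ)
  rw [sum_fin_one_arrow] at h
  simp_rw [sum_fin_one_arrow] at h
  rw [← Fintype.sum_prod_type'] at h
  convert h using 4 with ab
  simp

/-- **Row-local products are narrow with treewidth `≤ 2`**: `Π_a (β₀ + δ U + β R_a)`. [folklore] -/
theorem prod_rowLocal_mem_narrowSpan_two (n : ℕ) (β₀ δ β : ℂ) :
    (∏ a : Fin n,
      (C β₀ + C δ * ∑ i : Fin n, ∑ j : Fin n, (X (i, j) : MvPolynomial (Fin n × Fin n) ℂ) +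
        C β * ∑ j : Fin n, (X (a, j) : MvPolynomial (Fin n × Fin n) ℂ))) ∈
      Submodule.span ℂ {p : MvPolynomial (Fin n × Fin n) ℂ |
        ∃ (a b : ℕ) (E : Multiset (Fin a × Fin b)),
          treewidth (SimpleGraph.fromRel fun u v : Fin a ⊕ Fin b =>
            ∃ e ∈ E, u = Sum.inl e.1 ∧ v = Sum.inr e.2) ≤ 2 ∧ p = homPoly E n ℂ} := by
  refine NarrowSpanNewton.prod_mem_narrowSpan_of_psum_mem n 2 _ fun m => ?_
  have h := CorePatterns.sum_placements_pow_affineLocalForm_mem_narrowSpan n 1 0 m β₀ δ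
    (fun _ => 0) (fun _ => β) (fun _ => 0)
  rw [sum_fin_one_arrow] at h
  convert h using 4 with a
  simp

/-- **Column-local products are narrow with treewidth `≤ 2`**: `Π_b (β₀ + δ U + γ C_b)`. [folklore] -/
theorem prod_colLocal_mem_narrowSpan_two (n : ℕ) (β₀ δ γ : ℂ) :
    (∏ b : Fin n,
      (C β₀ + C δ * ∑ i : Fin n, ∑ j : Fin n, (X (i, j) : MvPolynomial (Fin n × Fin n) ℂ) +
        C γ * ∑ j : Fin n, (X (j, b) : MvPolynomial (Fin n × Fin n) ℂ))) ∈
      Submodule.span ℂ {p : MvPolynomial (Fin n × Fin n) ℂ |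
        ∃ (a b : ℕ) (E : Multiset (Fin a × Fin b)),
          treewidth (SimpleGraph.fromRel fun u v : Fin a ⊕ Fin b =>
            ∃ e ∈ E, u = Sum.inl e.1 ∧ v = Sum.inr e.2) ≤ 2 ∧ p = homPoly E n ℂ} := by
  refine NarrowSpanNewton.prod_mem_narrowSpan_of_psum_mem n 2 _ fun m => ?_
  have h := CorePatterns.sum_placements_pow_affineLocalForm_mem_narrowSpan n 0 1 m β₀ δ
    (fun _ => 0) (fun _ => 0) (fun _ => γ)
  simp_rw [sum_fin_one_arrow] at h
  convert h using 4 with b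
  simp

end SupportOneProducts

end Summit.ValiantsHypothesis.ValiantsHypothesis.Theorems

end
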